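import Literature.Algebra.Module.InfComapImageKernelProofs
import Literature.NumberTheory.GaloisRepresentations.GaloisCohomologyScalarAction
import HarnessLib

/-!
# Selmer groups of Selmer structures that agree off one place — the `loc_λ` identifications of
# Howard 2004 §1.5 (proofs file)

Topic `NumberTheory/GaloisRepresentations` (sequel to `LocalGlobalCohomology`: `SelmerStructure`,
`selmerGroup`, `galoisCohomology.localization`; to `GaloisCohomologyScalarAction`: the functorial
`R`-module structure `galoisCohomology.moduleH1`, `resₗ`; algebra from
`Algebra/Module/InfComapImageKernelProofs`).  THEOREMS ONLY: no definition, no named fact, no instance,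
no `sorry`.  Pure bookkeeping (first isomorphism theorem, Lagrange, additivity of length); no duality,
no class field theory.  The dictionary to `SelmerStructure.modify` (Howard's `F^q(n)`, `F_q(n)`, `F(n)`,
`F(nq)`) is the sequel `GaloisCohomology/SelmerStructureModifyOnePlaceProofs`.

## What is proved

Let `ρ` be a discrete Galois module over a number field `K`, `w` a place of `K`,
`loc = galoisCohomology.localization ρ w 1 : H¹(K, M) → H¹(K_w, M)`, and let `𝓡`, `𝓖` be two Selmer
structures which AGREE OFF `w` (`𝓖 v = 𝓡 v` for `v ≠ w`) with `𝓡` RELAXED at `w` (`𝓡 w = ⊤`); write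
`A = loc(H¹_𝓡(K, M)) ≤ H¹(K_w, M)`.  Then (§1, additive groups):

* `H¹_𝓖 = H¹_𝓡 ∩ loc⁻¹(𝓖_w)` (`selmerGroup_eq_inf_comap_of_eq_off`);
* **`loc(H¹_𝓖) = A ∩ 𝓖_w`** (`map_localization_selmerGroup_eq_of_eq_off`);
* `H¹_𝓖 ∩ ker loc = H¹_𝓡 ∩ ker loc`, and this is the Selmer group `H¹_𝓢` of the structure `𝓢` STRICT at
  `w` (`𝓢 w = ⊥`) agreeing with `𝓡` off `w` (`selmerGroup_eq_inf_ker_of_eq_bot_of_eq_off`);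
* **`H¹_𝓖 / H¹_𝓢 ≃+ A ∩ 𝓖_w`** (`nonempty_quotient_addEquiv_map_inf_of_eq_off`) and
  `#H¹_𝓖 = #H¹_𝓢 · #(A ∩ 𝓖_w)` (`natCard_selmerGroup_eq_mul_of_eq_off`).

§2 (`R`-modules): for an `R`-linear `ρ` (`IsScalarLinear R ρ`), the functorial `R`-module structures on
`H¹(K, M)`, `H¹(K_w, M)` (`moduleH1`), an `R`-linear `f` agreeing with `loc` (one exists:
`exists_linearMap_apply_eq_localization`), and `R`-submodules `S𝓖`, `S𝓢`, `SA`, `SC` whose underlying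
groups are `H¹_𝓖`, `H¹_𝓢`, `A`, `𝓖_w`:  **`len_R H¹_𝓖 = len_R H¹_𝓢 + len_R (A ∩ 𝓖_w)`**
(`length_selmerGroup_eq_add_of_eq_off`), an `R`-linear `H¹_𝓖 / H¹_𝓢 ≃ₗ[R] A ∩ 𝓖_w`, and the exponent
transfer **`r • H¹_𝓖 ≤ ker f ↔ r • (A ∩ 𝓖_w) = 0`** (`smul_selmerGroup_le_ker_iff_of_eq_off`).  The
submodules are typically `SelmerStructure.selmerSubmodule hρ 𝓛 h𝓛` / `galoisCohomology.submoduleOfStable …`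
(`GaloisCohomologyScalarActionLocalConditions`), whose underlying groups are the Selmer groups by `rfl`.

WHY (cell `pub/bsd-print-x9`, G87 = Howard 2004 Thm. 1.6.1 `Howard2004.thm161_dvrKolyvaginBound`, the print
leaf `stub_h161` of `MuInequalityCoherentPair` stmt-BirchSwinnertonDyer-22642; seat `bsd-line-x9-p1-w3` g14,
brick (LOC-ID)).  Howard, *The Heegner point Kolyvagin system*, Compositio Math. 140 (2004) §1.5
(= arXiv:1202.6340 §2.5, p. 10): the exact sequences
`0 → H¹_{F_ℓ(n)} → H¹_{F(n)} → H¹_f(K_ℓ)` and `0 → H¹_{F(n)} → H¹_{F^ℓ(n)} → H¹_s(K_ℓ)` (L1–4), «Let `A` be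
the local image of `𝓗^ℓ(n)` in `H¹(K_ℓ, T)` … Write `A_f` and `A_tr` for the intersections of `A` with
`H¹_f(K_ℓ, T)` and `H¹_tr(K_ℓ, T)` … Localization at `ℓ` gives an isomorphism» (L98–104), the four cokernels
of Lemma 1.5.8 and «`𝔪^{λ(n)}` kills the lower left quotient» in the proof of Prop. 1.5.9 (p. 11 L3–9), with
`𝓡 = F^ℓ(n)`, `𝓖 ∈ {F(n), F(nℓ)}`, `𝓢 = F_ℓ(n)`.  This file is the Galois-side dictionary between those
sentences and the module-theoretic bricks (`Literature/Algebra/Module/SymplecticTorsionModulesDVR`, …) and the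
induction skeleton of Lemma 1.6.4 (input «`Stub(n) ≤ ker loc_ℓ → Stub(nℓ) ≤ ker loc_ℓ`»).
Not here: the local splitting `H¹(K_λ, T) = H¹_f ⊕ H¹_tr` (Prop. 1.1.9), the maximal isotropy `A = A^⟂`
(Lemma 1.5.6, global duality), the structure theorem `𝓗(n) ≅ R^ε ⊕ M(n)²`.

References: [Howard2004HeegnerKolyvagin] B. Howard, Compositio Math. 140 (2004) §1.5 (arXiv:1202.6340 §2.5,
p. 10); [MazurRubinMemoirs2004] B. Mazur, K. Rubin, *Kolyvagin systems*, Mem. AMS 799 (2004), Def. 2.1.1.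
BSD is not proved by any of this.
-/

set_option autoImplicit false

noncomputable section

open NumberField

universe u v

namespace Literature.NumberTheory.GaloisRepresentations.DiscreteGaloisModule.SelmerStructure

open Literature.NumberTheory.GaloisRepresentations

variable {K : Type u} [Field K] [NumberField K] {M : Type u} [AddCommGroup M]
  [TopologicalSpace M] [DiscreteTopology M] {ρ : DiscreteGaloisModule K M}

/-! ## §1 Selmer structures agreeing off one place: the Selmer groups as additive groups -/

section Groups

variable {𝓡 𝓖 𝓢 : SelmerStructure ρ} {w : Place K}

/-- Membership: if `𝓡` is relaxed at `w` and `𝓖` agrees with `𝓡` off `w`, then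
`c ∈ H¹_𝓖 ↔ c ∈ H¹_𝓡 ∧ loc_w c ∈ 𝓖_w`.
[cite: Howard2004HeegnerKolyvagin, §1.5 (arXiv:1202.6340 §2.5, p. 10 L1–4)]
[cite: MazurRubinMemoirs2004, Def. 2.1.1] -/
theorem mem_selmerGroup_iff_of_eq_top_of_eq_off (hrel : 𝓡 w = ⊤) (hoff : ∀ v, v ≠ w → 𝓖 v = 𝓡 v)
    (c : galoisCohomology ρ 1) :
    c ∈ 𝓖.selmerGroup ↔ c ∈ 𝓡.selmerGroup ∧ galoisCohomology.localization ρ w 1 c ∈ 𝓖 w := by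
  simp only [mem_selmerGroup_iff]
  constructor
  · intro h
    refine ⟨fun v => ?_, h w⟩
    rcases eq_or_ne v w with rfl | hv
    · rw [hrel]
      exact AddSubgroup.mem_top _
    · rw [← hoff v hv]
      exact h v
  · rintro ⟨h, hw⟩ v
    rcases eq_or_ne v w with rfl | hv
    · exact hw
    · rw [hoff v hv]
      exact h v

/-- **`H¹_𝓖 = H¹_𝓡 ∩ loc_w⁻¹(𝓖_w)`** for `𝓡` relaxed at `w` and `𝓖` agreeing with `𝓡` off `w`.
[cite: Howard2004HeegnerKolyvagin, §1.5 (arXiv:1202.6340 §2.5, p. 10 L1–4)]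
[cite: MazurRubinMemoirs2004, Def. 2.1.1] -/
theorem selmerGroup_eq_inf_comap_of_eq_off (hrel : 𝓡 w = ⊤) (hoff : ∀ v, v ≠ w → 𝓖 v = 𝓡 v) :
    𝓖.selmerGroup = 𝓡.selmerGroup ⊓ (𝓖 w).comap (galoisCohomology.localization ρ w 1) := by
  ext c
  rw [mem_selmerGroup_iff_of_eq_top_of_eq_off hrel hoff, AddSubgroup.mem_inf, AddSubgroup.mem_comap]

/-- `H¹_𝓖 ≤ H¹_𝓡` (relaxing at `w` enlarges the Selmer group).
[cite: Howard2004HeegnerKolyvagin, §1.5 (arXiv:1202.6340 §2.5, p. 10 L1–4)] -/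
theorem selmerGroup_le_of_eq_top_of_eq_off (hrel : 𝓡 w = ⊤) (hoff : ∀ v, v ≠ w → 𝓖 v = 𝓡 v) :
    𝓖.selmerGroup ≤ 𝓡.selmerGroup := by
  rw [selmerGroup_eq_inf_comap_of_eq_off hrel hoff]
  exact inf_le_left

/-- **`loc_w(H¹_𝓖) = loc_w(H¹_𝓡) ∩ 𝓖_w`** — Howard's «`A_f = A ∩ H¹_f(K_ℓ, T)` is the local image of
`𝓗(n)`», «`A_tr = A ∩ H¹_tr` is the local image of `𝓗(nℓ)`», with `A = loc_ℓ(𝓗^ℓ(n))`.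
[cite: Howard2004HeegnerKolyvagin, Lemma 1.5.7 (proof) (arXiv:1202.6340 Lemma 2.5.7, p. 10 L98–104)] -/
theorem map_localization_selmerGroup_eq_of_eq_off (hrel : 𝓡 w = ⊤)
    (hoff : ∀ v, v ≠ w → 𝓖 v = 𝓡 v) :
    𝓖.selmerGroup.map (galoisCohomology.localization ρ w 1) =
      𝓡.selmerGroup.map (galoisCohomology.localization ρ w 1) ⊓ 𝓖 w := by
  rw [selmerGroup_eq_inf_comap_of_eq_off hrel hoff, AddSubgroup.map_inf_comap_eq_map_inf]

/-- `H¹_𝓖 ∩ ker loc_w = H¹_𝓡 ∩ ker loc_w`: the classes vanishing at `w` are the same for all structures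
agreeing off `w`. [cite: Howard2004HeegnerKolyvagin, §1.5 (arXiv:1202.6340 §2.5, p. 10 L1–4)] -/
theorem selmerGroup_inf_ker_eq_of_eq_off (hrel : 𝓡 w = ⊤) (hoff : ∀ v, v ≠ w → 𝓖 v = 𝓡 v) :
    𝓖.selmerGroup ⊓ (galoisCohomology.localization ρ w 1).ker =
      𝓡.selmerGroup ⊓ (galoisCohomology.localization ρ w 1).ker := by
  rw [selmerGroup_eq_inf_comap_of_eq_off hrel hoff, AddSubgroup.inf_comap_inf_ker]

/-- **The strict Selmer group is the kernel of localisation**: if `𝓢` is strict at `w` (`𝓢 w = ⊥`) and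
agrees with the relaxed `𝓡` off `w`, then `H¹_𝓢 = H¹_𝓡 ∩ ker loc_w` (exactness of
`0 → H¹_{F_ℓ(n)} → H¹_{F^ℓ(n)} → H¹(K_ℓ, T)`).
[cite: Howard2004HeegnerKolyvagin, §1.5 (arXiv:1202.6340 §2.5, p. 10 L1–4)] -/
theorem selmerGroup_eq_inf_ker_of_eq_bot_of_eq_off (hrel : 𝓡 w = ⊤) (hstr : 𝓢 w = ⊥)
    (hoffS : ∀ v, v ≠ w → 𝓢 v = 𝓡 v) :
    𝓢.selmerGroup = 𝓡.selmerGroup ⊓ (galoisCohomology.localization ρ w 1).ker := by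
  rw [selmerGroup_eq_inf_comap_of_eq_off hrel hoffS, hstr, AddMonoidHom.comap_bot]

/-- `H¹_𝓢 = H¹_𝓖 ∩ ker loc_w` for `𝓢` strict at `w`, `𝓖` arbitrary at `w`, both agreeing with `𝓡` off `w`
(exactness of `0 → H¹_{F_ℓ(n)} → H¹_{F(n)} → H¹_f(K_ℓ, T)` and of its `F(nℓ)`-twin).
[cite: Howard2004HeegnerKolyvagin, §1.5 (arXiv:1202.6340 §2.5, p. 10 L1–4)] -/
theorem selmerGroup_eq_selmerGroup_inf_ker_of_eq_off (hrel : 𝓡 w = ⊤)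
    (hoff : ∀ v, v ≠ w → 𝓖 v = 𝓡 v) (hstr : 𝓢 w = ⊥) (hoffS : ∀ v, v ≠ w → 𝓢 v = 𝓡 v) :
    𝓢.selmerGroup = 𝓖.selmerGroup ⊓ (galoisCohomology.localization ρ w 1).ker := by
  rw [selmerGroup_inf_ker_eq_of_eq_off hrel hoff, selmerGroup_eq_inf_ker_of_eq_bot_of_eq_off hrel hstr hoffS]

/-- `H¹_𝓢 ≤ H¹_𝓖` for `𝓢` strict at `w` and `𝓖` agreeing with it off `w`.
[cite: Howard2004HeegnerKolyvagin, §1.5 (arXiv:1202.6340 §2.5, p. 10 L1–4)] -/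
theorem selmerGroup_le_of_eq_bot_of_eq_off (hrel : 𝓡 w = ⊤) (hoff : ∀ v, v ≠ w → 𝓖 v = 𝓡 v)
    (hstr : 𝓢 w = ⊥) (hoffS : ∀ v, v ≠ w → 𝓢 v = 𝓡 v) : 𝓢.selmerGroup ≤ 𝓖.selmerGroup := by
  rw [selmerGroup_eq_selmerGroup_inf_ker_of_eq_off hrel hoff hstr hoffS]
  exact inf_le_left

/-- **First isomorphism: `H¹_𝓖 / H¹_𝓢 ≃+ loc_w(H¹_𝓡) ∩ 𝓖_w`** (the quotient taken by `H¹_𝓢` seen inside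
`H¹_𝓖`) — Howard's «`𝓗(n)/𝓗_ℓ(n) ≅ A_f`, `𝓗(nℓ)/𝓗_ℓ(n) ≅ A_tr`, `𝓗^ℓ(n)/𝓗_ℓ(n) ≅ A`».
[cite: Howard2004HeegnerKolyvagin, Lemma 1.5.7/1.5.8 (arXiv:1202.6340 p. 10 L98–104, L133–145)] -/
theorem nonempty_quotient_addEquiv_map_inf_of_eq_off (hrel : 𝓡 w = ⊤)
    (hoff : ∀ v, v ≠ w → 𝓖 v = 𝓡 v) (hstr : 𝓢 w = ⊥) (hoffS : ∀ v, v ≠ w → 𝓢 v = 𝓡 v) :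
    Nonempty (↥𝓖.selmerGroup ⧸ 𝓢.selmerGroup.addSubgroupOf 𝓖.selmerGroup ≃+
      ↥(𝓡.selmerGroup.map (galoisCohomology.localization ρ w 1) ⊓ 𝓖 w)) := by
  obtain ⟨e⟩ := AddSubgroup.nonempty_quotient_ker_addSubgroupOf_addEquiv_map
    (galoisCohomology.localization ρ w 1) 𝓖.selmerGroup
  have h1 : 𝓢.selmerGroup.addSubgroupOf 𝓖.selmerGroup =
      (galoisCohomology.localization ρ w 1).ker.addSubgroupOf 𝓖.selmerGroup := by
    rw [selmerGroup_eq_selmerGroup_inf_ker_of_eq_off hrel hoff hstr hoffS,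
      AddSubgroup.inf_addSubgroupOf_left]
  exact ⟨(QuotientAddGroup.quotientAddEquivOfEq h1).trans
    (e.trans (AddEquiv.addSubgroupCongr (map_localization_selmerGroup_eq_of_eq_off hrel hoff)))⟩

/-- **`#H¹_𝓖 = #H¹_𝓢 · #(loc_w(H¹_𝓡) ∩ 𝓖_w)`** (so, for the four structures of Howard's §1.5,
`#𝓗(n) = #𝓗_ℓ(n) · #A_f`, `#𝓗(nℓ) = #𝓗_ℓ(n) · #A_tr`, `#𝓗^ℓ(n) = #𝓗_ℓ(n) · #A`).
[cite: Howard2004HeegnerKolyvagin, Lemma 1.5.8 (arXiv:1202.6340 Lemma 2.5.8, p. 10 L133–145)] -/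
theorem natCard_selmerGroup_eq_mul_of_eq_off (hrel : 𝓡 w = ⊤) (hoff : ∀ v, v ≠ w → 𝓖 v = 𝓡 v)
    (hstr : 𝓢 w = ⊥) (hoffS : ∀ v, v ≠ w → 𝓢 v = 𝓡 v) :
    Nat.card ↥𝓖.selmerGroup = Nat.card ↥𝓢.selmerGroup *
      Nat.card ↥(𝓡.selmerGroup.map (galoisCohomology.localization ρ w 1) ⊓ 𝓖 w) := by
  rw [AddSubgroup.card_eq_card_inf_ker_mul_card_map (galoisCohomology.localization ρ w 1)
      𝓖.selmerGroup, ← selmerGroup_eq_selmerGroup_inf_ker_of_eq_off hrel hoff hstr hoffS,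
    map_localization_selmerGroup_eq_of_eq_off hrel hoff]

/-- The relaxed case of the preceding count: `#H¹_𝓡 = #H¹_𝓢 · #loc_w(H¹_𝓡)`.
[cite: Howard2004HeegnerKolyvagin, Lemma 1.5.8 (arXiv:1202.6340 Lemma 2.5.8, p. 10 L133–145)] -/
theorem natCard_selmerGroup_eq_mul_of_eq_top (hrel : 𝓡 w = ⊤) (hstr : 𝓢 w = ⊥)
    (hoffS : ∀ v, v ≠ w → 𝓢 v = 𝓡 v) :
    Nat.card ↥𝓡.selmerGroup = Nat.card ↥𝓢.selmerGroup *
      Nat.card ↥(𝓡.selmerGroup.map (galoisCohomology.localization ρ w 1)) := by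
  rw [natCard_selmerGroup_eq_mul_of_eq_off hrel (fun _ _ => rfl) hstr hoffS, hrel, inf_top_eq]

end Groups

/-! ## §2 The same for the `R`-module structures (`IsScalarLinear`, `moduleH1`): lengths and exponents -/

section Scalar

variable {R : Type v} [CommRing R] [Module R M]

variable {𝓡 𝓖 𝓢 : SelmerStructure ρ} {w : Place K}

/-- **`loc_w` is `R`-linear**: for the functorial `R`-module structures on `H¹(K, M)` and `H¹(K_w, M)`
there is an `R`-linear map agreeing with `loc_w` on elements (namely the tree's `galoisCohomology.resₗ`
to the completion `K_w`; `ρ.toLocal w` IS `GaloisRep.restrictField (Place.Completion w) ρ`).  The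
`R`-module statements below are phrased for ANY such `f`, so that a consumer may use its own.
[cite: Howard2004HeegnerKolyvagin, §1.1 («R-submodule of H¹(K_v, T)») and §1.5 (arXiv:1202.6340 p. 5 L3–24, p. 10 L1–4)] -/
theorem exists_linearMap_apply_eq_localization (hρ : ρ.IsScalarLinear R) :
    letI := galoisCohomology.moduleH1 ρ hρ
    letI := galoisCohomology.moduleH1 (ρ.toLocal w) (hρ.restrictField (Place.Completion w))
    ∃ f : galoisCohomology ρ 1 →ₗ[R] galoisCohomology (ρ.toLocal w) 1,
      ∀ c, f c = galoisCohomology.localization ρ w 1 c :=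
  ⟨galoisCohomology.resₗ hρ (Place.Completion w), fun _ => rfl⟩

/-- **`R`-module version of the identifications.**  With the functorial `R`-module structures on
`H¹(K, M)` and `H¹(K_w, M)`, an `R`-linear `f` agreeing with `loc_w`, and `R`-submodules `S𝓖`, `S𝓢` of
`H¹(K, M)` and `SA`, `SC` of `H¹(K_w, M)` whose underlying groups are `H¹_𝓖`, `H¹_𝓢`, `A = loc_w(H¹_𝓡)` and
`𝓖_w` (e.g. built with `galoisCohomology.submoduleOfStable`):  `S𝓢 = S𝓖 ∩ ker f` and `f(S𝓖) = SA ∩ SC`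
as `R`-submodules.
[cite: Howard2004HeegnerKolyvagin, Lemma 1.5.7/1.5.8 (arXiv:1202.6340 p. 10 L98–104, L133–145)] -/
theorem submodule_eq_and_map_eq_of_eq_off (hrel : 𝓡 w = ⊤) (hoff : ∀ v, v ≠ w → 𝓖 v = 𝓡 v)
    (hstr : 𝓢 w = ⊥) (hoffS : ∀ v, v ≠ w → 𝓢 v = 𝓡 v) (hρ : ρ.IsScalarLinear R) :
    letI := galoisCohomology.moduleH1 ρ hρ
    letI := galoisCohomology.moduleH1 (ρ.toLocal w) (hρ.restrictField (Place.Completion w))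
    ∀ (f : galoisCohomology ρ 1 →ₗ[R] galoisCohomology (ρ.toLocal w) 1)
      (S𝓖 S𝓢 : Submodule R (galoisCohomology ρ 1))
      (SA SC : Submodule R (galoisCohomology (ρ.toLocal w) 1)),
      (∀ c, f c = galoisCohomology.localization ρ w 1 c) →
      S𝓖.toAddSubgroup = 𝓖.selmerGroup → S𝓢.toAddSubgroup = 𝓢.selmerGroup →
      SA.toAddSubgroup = 𝓡.selmerGroup.map (galoisCohomology.localization ρ w 1) →
      SC.toAddSubgroup = 𝓖 w →
      S𝓢 = S𝓖 ⊓ LinearMap.ker f ∧ S𝓖.map f = SA ⊓ SC := by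
  letI := galoisCohomology.moduleH1 ρ hρ
  letI := galoisCohomology.moduleH1 (ρ.toLocal w) (hρ.restrictField (Place.Completion w))
  intro f S𝓖 S𝓢 SA SC hf hS𝓖 hS𝓢 hSA hSC
  have hkerS := selmerGroup_eq_selmerGroup_inf_ker_of_eq_off hrel hoff hstr hoffS
  have hmap := map_localization_selmerGroup_eq_of_eq_off hrel hoff
  have e𝓖 : ∀ x, x ∈ S𝓖 ↔ x ∈ 𝓖.selmerGroup := fun x => by
    rw [← Submodule.mem_toAddSubgroup, hS𝓖]
  have e𝓢 : ∀ x, x ∈ S𝓢 ↔ x ∈ 𝓢.selmerGroup := fun x => by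
    rw [← Submodule.mem_toAddSubgroup, hS𝓢]
  have eA : ∀ y, y ∈ SA ↔ y ∈ 𝓡.selmerGroup.map (galoisCohomology.localization ρ w 1) :=
    fun y => by rw [← Submodule.mem_toAddSubgroup, hSA]
  have eC : ∀ y, y ∈ SC ↔ y ∈ 𝓖 w := fun y => by
    rw [← Submodule.mem_toAddSubgroup, hSC]
  constructor
  · ext x
    rw [e𝓢, hkerS, AddSubgroup.mem_inf, AddMonoidHom.mem_ker, Submodule.mem_inf, e𝓖,
      LinearMap.mem_ker, hf]
  · ext y
    rw [Submodule.mem_inf, eA, eC, ← AddSubgroup.mem_inf, ← hmap, AddSubgroup.mem_map,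
      Submodule.mem_map]
    constructor
    · rintro ⟨x, hx, rfl⟩
      exact ⟨x, (e𝓖 x).1 hx, (hf x).symm⟩
    · rintro ⟨x, hx, rfl⟩
      exact ⟨x, (e𝓖 x).2 hx, hf x⟩

/-- **`len_R H¹_𝓖 = len_R H¹_𝓢 + len_R (A ∩ 𝓖_w)`** — the length count behind Lemma 1.5.8's diagram
and Prop. 1.5.9 (`len 𝓗(n) = len 𝓗_ℓ(n) + len A_f`, `len 𝓗(nℓ) = len 𝓗_ℓ(n) + len A_tr`,
`len 𝓗^ℓ(n) = len 𝓗_ℓ(n) + len A`), for `R`-submodules with the stated underlying groups.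
[cite: Howard2004HeegnerKolyvagin, Lemma 1.5.8 and Prop. 1.5.9 (arXiv:1202.6340 p. 10 L133–145, p. 11 L3–9)] -/
theorem length_selmerGroup_eq_add_of_eq_off (hrel : 𝓡 w = ⊤) (hoff : ∀ v, v ≠ w → 𝓖 v = 𝓡 v)
    (hstr : 𝓢 w = ⊥) (hoffS : ∀ v, v ≠ w → 𝓢 v = 𝓡 v) (hρ : ρ.IsScalarLinear R) :
    letI := galoisCohomology.moduleH1 ρ hρ
    letI := galoisCohomology.moduleH1 (ρ.toLocal w) (hρ.restrictField (Place.Completion w))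
    ∀ (S𝓖 S𝓢 : Submodule R (galoisCohomology ρ 1))
      (SA SC : Submodule R (galoisCohomology (ρ.toLocal w) 1)),
      S𝓖.toAddSubgroup = 𝓖.selmerGroup → S𝓢.toAddSubgroup = 𝓢.selmerGroup →
      SA.toAddSubgroup = 𝓡.selmerGroup.map (galoisCohomology.localization ρ w 1) →
      SC.toAddSubgroup = 𝓖 w →
      Module.length R ↥S𝓖 = Module.length R ↥S𝓢 + Module.length R ↥(SA ⊓ SC) := by
  letI := galoisCohomology.moduleH1 ρ hρ
  letI := galoisCohomology.moduleH1 (ρ.toLocal w) (hρ.restrictField (Place.Completion w))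
  intro S𝓖 S𝓢 SA SC hS𝓖 hS𝓢 hSA hSC
  obtain ⟨f, hf⟩ := exists_linearMap_apply_eq_localization (w := w) hρ
  obtain ⟨h1, h2⟩ := submodule_eq_and_map_eq_of_eq_off hrel hoff hstr hoffS hρ f S𝓖 S𝓢 SA SC
    hf hS𝓖 hS𝓢 hSA hSC
  rw [Submodule.length_eq_length_inf_ker_add_length_map f S𝓖, ← h1, h2]

/-- **`R`-linear first isomorphism `H¹_𝓖 / H¹_𝓢 ≃ₗ[R] A ∩ 𝓖_w`** (quotient by `H¹_𝓢` pulled back into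
`H¹_𝓖`), for `R`-submodules with the stated underlying groups.
[cite: Howard2004HeegnerKolyvagin, Lemma 1.5.7 (proof) (arXiv:1202.6340 Lemma 2.5.7, p. 10 L98–104)] -/
theorem nonempty_quotient_linearEquiv_map_inf_of_eq_off (hrel : 𝓡 w = ⊤)
    (hoff : ∀ v, v ≠ w → 𝓖 v = 𝓡 v) (hstr : 𝓢 w = ⊥) (hoffS : ∀ v, v ≠ w → 𝓢 v = 𝓡 v)
    (hρ : ρ.IsScalarLinear R) :
    letI := galoisCohomology.moduleH1 ρ hρ
    letI := galoisCohomology.moduleH1 (ρ.toLocal w) (hρ.restrictField (Place.Completion w))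
    ∀ (S𝓖 S𝓢 : Submodule R (galoisCohomology ρ 1))
      (SA SC : Submodule R (galoisCohomology (ρ.toLocal w) 1)),
      S𝓖.toAddSubgroup = 𝓖.selmerGroup → S𝓢.toAddSubgroup = 𝓢.selmerGroup →
      SA.toAddSubgroup = 𝓡.selmerGroup.map (galoisCohomology.localization ρ w 1) →
      SC.toAddSubgroup = 𝓖 w →
      Nonempty ((↥S𝓖 ⧸ S𝓢.comap S𝓖.subtype) ≃ₗ[R] ↥(SA ⊓ SC)) := by
  letI := galoisCohomology.moduleH1 ρ hρ
  letI := galoisCohomology.moduleH1 (ρ.toLocal w) (hρ.restrictField (Place.Completion w))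
  intro S𝓖 S𝓢 SA SC hS𝓖 hS𝓢 hSA hSC
  obtain ⟨f, hf⟩ := exists_linearMap_apply_eq_localization (w := w) hρ
  obtain ⟨h1, h2⟩ := submodule_eq_and_map_eq_of_eq_off hrel hoff hstr hoffS hρ f S𝓖 S𝓢 SA SC
    hf hS𝓖 hS𝓢 hSA hSC
  have hk : LinearMap.ker (f.domRestrict S𝓖) = S𝓢.comap S𝓖.subtype := by
    rw [h1]
    ext x
    simp [LinearMap.mem_ker, Submodule.mem_comap]
  have hr : LinearMap.range (f.domRestrict S𝓖) = SA ⊓ SC := by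
    rw [LinearMap.range_domRestrict, h2]
  exact ⟨(Submodule.quotEquivOfEq _ _ hk.symm).trans
    ((LinearMap.quotKerEquivRange (f.domRestrict S𝓖)).trans (LinearEquiv.ofEq _ _ hr))⟩

open Pointwise in
/-- **Exponent transfer: `r • H¹_𝓖 ≤ ker loc_w ↔ r • (A ∩ 𝓖_w) = 0`** — «`loc_ℓ(Stub(n)) = 0` implies that
`𝔪^{λ(n)}` kills the lower left quotient» (`Stub(n) = 𝔪^{λ(n)} 𝓗(n)`, the lower left quotient being
`𝓗(n)/𝓗_ℓ(n) ≅ A_f`), and conversely; for an `R`-linear `f` agreeing with `loc_w` and `R`-submodules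
with the stated underlying groups.
[cite: Howard2004HeegnerKolyvagin, Prop. 1.5.9 (proof) (arXiv:1202.6340 Prop. 2.5.9, p. 11 L3–9)] -/
theorem smul_selmerGroup_le_ker_iff_of_eq_off (hrel : 𝓡 w = ⊤) (hoff : ∀ v, v ≠ w → 𝓖 v = 𝓡 v)
    (hρ : ρ.IsScalarLinear R) (r : R) :
    letI := galoisCohomology.moduleH1 ρ hρ
    letI := galoisCohomology.moduleH1 (ρ.toLocal w) (hρ.restrictField (Place.Completion w))
    ∀ (f : galoisCohomology ρ 1 →ₗ[R] galoisCohomology (ρ.toLocal w) 1)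
      (S𝓖 : Submodule R (galoisCohomology ρ 1))
      (SA SC : Submodule R (galoisCohomology (ρ.toLocal w) 1)),
      (∀ c, f c = galoisCohomology.localization ρ w 1 c) →
      S𝓖.toAddSubgroup = 𝓖.selmerGroup →
      SA.toAddSubgroup = 𝓡.selmerGroup.map (galoisCohomology.localization ρ w 1) →
      SC.toAddSubgroup = 𝓖 w →
      (r • S𝓖 ≤ LinearMap.ker f ↔ r • (SA ⊓ SC) = ⊥) := by
  letI := galoisCohomology.moduleH1 ρ hρ
  letI := galoisCohomology.moduleH1 (ρ.toLocal w) (hρ.restrictField (Place.Completion w))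
  intro f S𝓖 SA SC hf hS𝓖 hSA hSC
  have hmap := map_localization_selmerGroup_eq_of_eq_off hrel hoff
  have e𝓖 : ∀ x, x ∈ S𝓖 ↔ x ∈ 𝓖.selmerGroup := fun x => by
    rw [← Submodule.mem_toAddSubgroup, hS𝓖]
  have eA : ∀ y, y ∈ SA ↔ y ∈ 𝓡.selmerGroup.map (galoisCohomology.localization ρ w 1) :=
    fun y => by rw [← Submodule.mem_toAddSubgroup, hSA]
  have eC : ∀ y, y ∈ SC ↔ y ∈ 𝓖 w := fun y => by
    rw [← Submodule.mem_toAddSubgroup, hSC]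
  have h2 : S𝓖.map f = SA ⊓ SC := by
    ext y
    rw [Submodule.mem_inf, eA, eC, ← AddSubgroup.mem_inf, ← hmap, AddSubgroup.mem_map,
      Submodule.mem_map]
    constructor
    · rintro ⟨x, hx, rfl⟩
      exact ⟨x, (e𝓖 x).1 hx, (hf x).symm⟩
    · rintro ⟨x, hx, rfl⟩
      exact ⟨x, (e𝓖 x).2 hx, hf x⟩
  rw [Submodule.smul_le_ker_iff_smul_map_eq_bot, h2]

end Scalar

end Literature.NumberTheory.GaloisRepresentations.DiscreteGaloisModule.SelmerStructure

end
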